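import Literature.NumberTheory.ConnesConsani2021.SemilocalSoninSpace
import Literature.Analysis.OperatorTheory.LpDilationContinuity
import HarnessLib

/-!
# The twist `θ_p` commutes with the scaling action: semilocal matrix coefficients, trace functional
# and Gram form in ARCHIMEDEAN terms (Connes–Consani–Moscovici 2024, §4.6–§4.8, made quantitative)

Continuation (theorems + one elementary definition) of `SemilocalSoninSpace.lean`.  There the semilocal
Sonin space of A. Connes, C. Consani, H. Moscovici, *Zeta zeros and prolate wave operators*, Ann. Funct.
Anal. 15 (2024) = arXiv:2310.18423 [bib: `ConnesConsaniMoscovici2024`], Def. 4.5 / Thm. 4.6, is pulled back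
to `L²(ℝ)_ev` as `𝔖_S(α,β) = θ_p(S(α,β))` with the PRINTED twist `θ_p = 1 − p^{-1/2}ϑ(p)`
(`primeTwist`; Mellin multiplier `1 − p^{−1/2−is}`, §4.6 Lemma (ii) p. 14).  CCM 2024 §4.8 (p. 15) remark
that "the hilbertian structure of the Sonin spaces `𝔖_λ(X_S, α)` is independent of `S` … the choice of
the finite set `S` plays a key role in fixing the inner product", and defer "the computation of the
coefficients of the hermitian Jacobi matrix of the cyclic pair for a general `S`" to a forthcoming paper
(p. 5).  This file records the elementary identities behind that remark, in the vocabulary of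
A. Connes, C. Consani, *Weil positivity and trace formula, the archimedean place*, Selecta Math. 27 (2021)
[bib: `ConnesConsani2021`] (`scalingCoeff ξ η τ = ⟨ξ | ϑ(e^τ) η⟩`, `soninTraceForm k ξ = ∫ k(τ)⟨ξ|ϑ(e^τ)ξ⟩dτ`):
since `θ_p` lies in the abelian algebra generated by the scaling representation `ϑ`, it commutes with
every `ϑ(λ)`, and

* `scalingCoeff_primeTwist`:
  `⟨θ_pξ | ϑ(e^τ) θ_pη⟩ = (1 + p⁻¹)⟨ξ|ϑ(e^τ)η⟩ − p^{-1/2}(⟨ξ|ϑ(e^{τ+log p})η⟩ + ⟨ξ|ϑ(e^{τ−log p})η⟩)`;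
* `soninTraceForm_primeTwist`: `⟨θ_pξ | ϑ(k) θ_pξ⟩ = ⟨ξ | ϑ(T_p k) ξ⟩` with the 3-point twist
  `(T_p k)(τ) = (1 + p⁻¹)k(τ) − p^{-1/2}(k(τ − log p) + k(τ + log p))` (`twistKernel`), i.e. `T_p k = k ∗ m_p`,
  `m_p = (1 + p⁻¹)δ₀ − p^{-1/2}(δ_{log p} + δ_{−log p})` = the measure of `θ_p* θ_p`, Mellin symbol
  `|1 − p^{−1/2−is}|²`;
* `inner_primeTwist_primeTwist`: the Gram form `⟪θ_pζ, θ_pζ'⟫ = (1 + p⁻¹)⟪ζ,ζ'⟫ − p^{-1/2}(⟨ζ|ϑ(p)ζ'⟩ + ⟨ζ|ϑ(p⁻¹)ζ'⟩)`;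
* `semilocal_weakTrace_iff`: consequently every weak-trace inequality
  "`Σ_i Re⟨ξ_i|ϑ(k)ξ_i⟩ ≤ C` for all finite orthonormal families `ξ_i ∈ 𝔖_S(α,β)`" is EQUIVALENT to
  "`Σ_i Re⟨ζ_i|ϑ(T_p k)ζ_i⟩ ≤ C` for all finite families `ζ_i` of CC's ARCHIMEDEAN Sonin space `S(α,β)` with
  `(θ_pζ_i)` orthonormal" — the prime enters only through the twist of the kernel and of the Gram form.

On the way: the scaling coefficient as an inner product against the tree's `L²` dilation
(`scalingCoeff_eq_inner`), the adjoint relation `⟪D_aξ, ζ⟫ = |a|⁻¹⟪ξ, D_{a⁻¹}ζ⟫` (`inner_lpDilation_left`),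
the bound `|⟨ξ|ϑ(e^τ)η⟩| ≤ ‖ξ‖‖η‖`, continuity of `τ ↦ ⟨ξ|ϑ(e^τ)η⟩` (strong continuity of dilations,
`LpDilationContinuity.lean`) and integrability of `k(τ)⟨ξ|ϑ(e^τ)η⟩` for `k ∈ L¹`.

All statements are [folklore]-level consequences of the printed formula for `θ_S`; nothing here is an
inequality with a prime, and nothing here is claimed to be in print beyond the objects.  The cell
`rh-explicit` (HOME/cc-s2-1/S2-STATEMENT.md §8) uses `semilocal_weakTrace_iff` to restate its summit-side
obligation `SemilocalSoninIneqOn p a` over `S(1,1)`.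

## Deliberately NOT here

`L²(X_S)`, the semilocal Fourier transform, de Branges spaces, any trace-class statement, any inequality.
-/

noncomputable section

open _root_.MeasureTheory Complex Set Filter
open scoped Real ComplexConjugate ENNReal InnerProductSpace Topology

namespace Literature.NumberTheory.ConnesConsani2021

open Literature.NumberTheory.LFunctions Literature.Analysis.OperatorTheory

/-- Local shorthand for the tree's `L²(ℝ; ℂ)` dilation `ξ ↦ ξ(a ·)` at exponent `2`. -/
local notation "𝔇[" a ", " ha "]" =>
  lpDilation (V := ℝ) (F := ℂ) (p := (2 : ℝ≥0∞)) a ha ENNReal.ofNat_ne_top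

/-! ## The scaling coefficient `⟨ξ | ϑ(e^τ) η⟩` through the `L²` dilation -/

section ScalingCoeff

/-- Changing the scale parameter of `lpDilation` along an equality of reals (proof irrelevance;
plumbing). [folklore] -/
private theorem lpDilation_congr_scale {a b : ℝ} (h : a = b) (ha : a ≠ 0) (hb : b ≠ 0) :
    (𝔇[a, ha] : Lp ℂ 2 (volume : Measure ℝ) →L[ℂ] Lp ℂ 2 (volume : Measure ℝ)) = 𝔇[b, hb] := by
  subst h
  rfl

/-- **The scaling coefficient is an inner product against a dilation**:
`⟨ξ | ϑ(e^τ) η⟩ = e^{−τ/2} ⟪ξ, D_{e^{−τ}} η⟫_{L²(ℝ)}` (`(ϑ(λ)η)(v) = λ^{−1/2}η(λ⁻¹v)`, CC 2021 eq. (40)).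
[cite: ConnesConsani2021, §4 eq. (40) p. 15] -/
theorem scalingCoeff_eq_inner (ξ η : Lp ℂ 2 (volume : Measure ℝ)) (τ : ℝ) :
    scalingCoeff ξ η τ =
      (Real.exp (-τ / 2) : ℂ) * ⟪ξ, 𝔇[Real.exp (-τ), (Real.exp_pos _).ne'] η⟫_ℂ := by
  rw [MeasureTheory.L2.inner_def, ← integral_const_mul]
  unfold scalingCoeff
  refine integral_congr_ae ?_
  filter_upwards [lpDilation_coeFn (V := ℝ) (F := ℂ) (p := (2 : ℝ≥0∞)) (Real.exp_pos (-τ)).ne'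
    ENNReal.ofNat_ne_top η] with v hv
  rw [RCLike.inner_apply', hv, smul_eq_mul]
  ring

/-- The same identity solved for the inner product: `⟪ξ, D_{e^{−σ}} η⟫ = e^{σ/2} ⟨ξ | ϑ(e^σ) η⟩`.
[cite: ConnesConsani2021, §4 eq. (40) p. 15] -/
theorem inner_lpDilation_exp (ξ η : Lp ℂ 2 (volume : Measure ℝ)) (σ : ℝ) :
    ⟪ξ, 𝔇[Real.exp (-σ), (Real.exp_pos _).ne'] η⟫_ℂ = (Real.exp (σ / 2) : ℂ) * scalingCoeff ξ η σ := by
  rw [scalingCoeff_eq_inner, ← mul_assoc, ← Complex.ofReal_mul, ← Real.exp_add,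
    show σ / 2 + -σ / 2 = 0 by ring, Real.exp_zero, Complex.ofReal_one, one_mul]

/-- The `L²` scaling law at scale `e^{−τ}`: `‖η(e^{−τ} ·)‖₂ = e^{τ/2}‖η‖₂` (the case `p = 2`, `d = 1`,
`a = e^{−τ}` of `‖g(a ·)‖_p = |a^d|^{−1/p}‖g‖_p`). [cite: SteinWeiss1971, Ch. I §1] -/
theorem norm_lpDilation_exp (η : Lp ℂ 2 (volume : Measure ℝ)) (τ : ℝ) :
    ‖𝔇[Real.exp (-τ), (Real.exp_pos _).ne'] η‖ = Real.exp (τ / 2) * ‖η‖ := by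
  rw [norm_lpDilation_apply]
  congr 1
  rw [Module.finrank_self, pow_one, Real.exp_neg, inv_inv, abs_of_pos (Real.exp_pos _),
    show (1 / (2 : ℝ≥0∞)).toReal = (1 / 2 : ℝ) by simp, ← ENNReal.toReal_rpow,
    ENNReal.toReal_ofReal (Real.exp_pos _).le, ← Real.exp_mul]
  congr 1
  ring

/-- **`|⟨ξ | ϑ(e^τ) η⟩| ≤ ‖ξ‖ ‖η‖`**: Cauchy–Schwarz and unitarity of CC's scaling representation `ϑ`
(eq. (40): "the unitary representation `ϑ` of `ℝ₊*`"; elementary property of the printed object).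
[cite: ConnesConsani2021, §4 eq. (40) p. 15] -/
theorem norm_scalingCoeff_le (ξ η : Lp ℂ 2 (volume : Measure ℝ)) (τ : ℝ) :
    ‖scalingCoeff ξ η τ‖ ≤ ‖ξ‖ * ‖η‖ := by
  rw [scalingCoeff_eq_inner, norm_mul, Complex.norm_real, Real.norm_eq_abs,
    abs_of_pos (Real.exp_pos _)]
  calc Real.exp (-τ / 2) * ‖⟪ξ, 𝔇[Real.exp (-τ), (Real.exp_pos _).ne'] η⟫_ℂ‖
      ≤ Real.exp (-τ / 2) * (‖ξ‖ * ‖𝔇[Real.exp (-τ), (Real.exp_pos _).ne'] η‖) := by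
        gcongr
        exact norm_inner_le_norm _ _
    _ = ‖ξ‖ * ‖η‖ := by
        rw [norm_lpDilation_exp]
        have e : Real.exp (-τ / 2) * Real.exp (τ / 2) = 1 := by
          rw [← Real.exp_add, show -τ / 2 + τ / 2 = 0 by ring, Real.exp_zero]
        linear_combination (‖ξ‖ * ‖η‖) * e

/-- **Continuity of `τ ↦ ⟨ξ | ϑ(e^τ) η⟩`**: matrix coefficients of the (strongly continuous, unitary)
scaling representation `ϑ` of eq. (40) are continuous — strong continuity of dilations on `L²` is the tree's
`continuous_lpDilation_apply` (Stein–Weiss, Ch. I §1); elementary property of the printed object.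
[cite: ConnesConsani2021, §4 eq. (40) p. 15] -/
theorem continuous_scalingCoeff (ξ η : Lp ℂ 2 (volume : Measure ℝ)) :
    Continuous fun τ : ℝ => scalingCoeff ξ η τ := by
  have h1 : Continuous fun τ : ℝ => (Real.exp (-τ / 2) : ℂ) := by fun_prop
  have h2 : Continuous fun τ : ℝ => 𝔇[Real.exp (-τ), (Real.exp_pos (-τ)).ne'] η :=
    continuous_lpDilation_apply (V := ℝ) (F := ℂ) ENNReal.ofNat_ne_top η
      (a := fun τ : ℝ => Real.exp (-τ)) (by fun_prop) fun τ => (Real.exp_pos (-τ)).ne'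
  have h3 : Continuous fun τ : ℝ => ⟪ξ, 𝔇[Real.exp (-τ), (Real.exp_pos (-τ)).ne'] η⟫_ℂ :=
    continuous_const.inner h2
  have h4 : (fun τ : ℝ => scalingCoeff ξ η τ) =
      fun τ => (Real.exp (-τ / 2) : ℂ) * ⟪ξ, 𝔇[Real.exp (-τ), (Real.exp_pos (-τ)).ne'] η⟫_ℂ :=
    funext fun τ => scalingCoeff_eq_inner ξ η τ
  rw [h4]
  exact h1.mul h3

/-- For `k ∈ L¹(ℝ)` the integrand `k(τ)⟨ξ | ϑ(e^τ) η⟩` of the printed `⟨ξ | ϑ(f) η⟩ = ∫ f(λ)⟨ξ|ϑ(λ)η⟩d*λ`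
(proof of Prop. 2.2 (iii), `k = f ∘ exp`) is integrable (bounded continuous times `L¹`).
[cite: ConnesConsani2021, Prop. 2.2 (iii) p. 10] -/
theorem integrable_mul_scalingCoeff {k : ℝ → ℂ} (hk : Integrable k) (ξ η : Lp ℂ 2 (volume : Measure ℝ)) :
    Integrable fun τ : ℝ => k τ * scalingCoeff ξ η τ :=
  hk.mul_bdd (continuous_scalingCoeff ξ η).aestronglyMeasurable
    (Eventually.of_forall (norm_scalingCoeff_le ξ η))

/-- Shifted version: `k(τ)⟨ξ | ϑ(e^{τ+c}) η⟩` is integrable for `k ∈ L¹` (same printed object,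
translated kernel). [cite: ConnesConsani2021, Prop. 2.2 (iii) p. 10] -/
theorem integrable_mul_scalingCoeff_shift {k : ℝ → ℂ} (hk : Integrable k)
    (ξ η : Lp ℂ 2 (volume : Measure ℝ)) (c : ℝ) :
    Integrable fun τ : ℝ => k τ * scalingCoeff ξ η (τ + c) :=
  hk.mul_bdd ((continuous_scalingCoeff ξ η).comp (continuous_id.add continuous_const)).aestronglyMeasurable
    (Eventually.of_forall fun τ => norm_scalingCoeff_le ξ η (τ + c))

/-- **Adjoint relation of dilations in `L²(ℝ)`**: `⟪D_a ξ, ζ⟫ = |a|⁻¹ ⟪ξ, D_{a⁻¹} ζ⟫` (substitute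
`v = a⁻¹w`; the Jacobian `|a|⁻¹` of the dilation, Stein–Weiss Ch. I §1 — equivalently `a^{1/2}D_a` is
unitary, CC 2021 eq. (40)). [cite: SteinWeiss1971, Ch. I §1] -/
theorem inner_lpDilation_left (ξ ζ : Lp ℂ 2 (volume : Measure ℝ)) {a : ℝ} (ha : a ≠ 0) :
    ⟪𝔇[a, ha] ξ, ζ⟫_ℂ = ((|a|⁻¹ : ℝ) : ℂ) * ⟪ξ, 𝔇[a⁻¹, inv_ne_zero ha] ζ⟫_ℂ := by
  rw [MeasureTheory.L2.inner_def, MeasureTheory.L2.inner_def]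
  have h1 : (fun v : ℝ => ⟪(𝔇[a, ha] ξ : ℝ → ℂ) v, (ζ : ℝ → ℂ) v⟫_ℂ) =ᵐ[volume]
      fun v => conj ((ξ : ℝ → ℂ) (a * v)) * (ζ : ℝ → ℂ) v := by
    filter_upwards [lpDilation_coeFn (V := ℝ) (F := ℂ) (p := (2 : ℝ≥0∞)) ha ENNReal.ofNat_ne_top ξ]
      with v hv
    rw [RCLike.inner_apply', hv, smul_eq_mul]
  have h2 : (fun w : ℝ => ⟪(ξ : ℝ → ℂ) w, (𝔇[a⁻¹, inv_ne_zero ha] ζ : ℝ → ℂ) w⟫_ℂ) =ᵐ[volume]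
      fun w => conj ((ξ : ℝ → ℂ) w) * (ζ : ℝ → ℂ) (a⁻¹ * w) := by
    filter_upwards [lpDilation_coeFn (V := ℝ) (F := ℂ) (p := (2 : ℝ≥0∞)) (inv_ne_zero ha)
      ENNReal.ofNat_ne_top ζ] with w hw
    rw [RCLike.inner_apply', hw, smul_eq_mul]
  rw [integral_congr_ae h1, integral_congr_ae h2]
  have h3 := Measure.integral_comp_mul_left
    (fun w : ℝ => conj ((ξ : ℝ → ℂ) w) * (ζ : ℝ → ℂ) (a⁻¹ * w)) a
  have h4 : (fun x : ℝ => conj ((ξ : ℝ → ℂ) (a * x)) * (ζ : ℝ → ℂ) (a⁻¹ * (a * x))) =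
      fun x => conj ((ξ : ℝ → ℂ) (a * x)) * (ζ : ℝ → ℂ) x := by
    funext x
    rw [inv_mul_cancel_left₀ ha]
  simp only [h4] at h3
  rw [h3, Complex.real_smul, abs_inv]

end ScalingCoeff

/-! ## The twist `θ_p` against the scaling coefficients -/

section Twist

variable (p : ℕ) [hp : Fact p.Prime]

/-- **`θ_p` commutes with the scaling action — the twisted matrix coefficient.**  For `ξ, η ∈ L²(ℝ)`:
`⟨θ_pξ | ϑ(e^τ) θ_pη⟩ = (1 + p⁻¹)⟨ξ|ϑ(e^τ)η⟩ − p^{−1/2}(⟨ξ|ϑ(e^{τ+log p})η⟩ + ⟨ξ|ϑ(e^{τ−log p})η⟩)`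
(`p^{−1/2} = e^{−(log p)/2}`).  Proof: `θ_p = 1 − p⁻¹D_{p⁻¹}`, sesquilinearity, `D_aD_b = D_{ba}` and
`⟪D_aξ, ζ⟫ = |a|⁻¹⟪ξ, D_{a⁻¹}ζ⟫`; this is the position-space form of multiplying Mellin transforms by
`|1 − p^{−1/2−is}|² = 1 + p⁻¹ − 2p^{−1/2}cos(s log p)`.
[cite: ConnesConsaniMoscovici2024, §4.6 Lemma after Def. 4.5 (ii) p. 14; §4.8 p. 15] -/
theorem scalingCoeff_primeTwist (ξ η : Lp ℂ 2 (volume : Measure ℝ)) (τ : ℝ) :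
    scalingCoeff (primeTwist p ξ) (primeTwist p η) τ =
      (1 + (p : ℂ)⁻¹) * scalingCoeff ξ η τ
        - (Real.exp (-(Real.log p / 2)) : ℂ) *
          (scalingCoeff ξ η (τ + Real.log p) + scalingCoeff ξ η (τ - Real.log p)) := by
  set L : ℝ := Real.log p with hL
  have hp0 : (0 : ℝ) < p := by exact_mod_cast hp.out.pos
  have hpne : (p : ℝ) ≠ 0 := hp0.ne'
  have hpL : Real.exp L = p := Real.exp_log hp0
  have hpinv : (p : ℝ)⁻¹ ≠ 0 := inv_ne_zero hpne
  -- the two dilations in play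
  have hθ : ∀ ζ : Lp ℂ 2 (volume : Measure ℝ),
      primeTwist p ζ = ζ - (p : ℂ)⁻¹ • 𝔇[((p : ℝ)⁻¹), hpinv] ζ := fun ζ => by
    simp [primeTwist]
  rw [scalingCoeff_eq_inner, hθ ξ, hθ η, map_sub, map_smul, inner_sub_left, inner_sub_right,
    inner_sub_right, inner_smul_right, inner_smul_right, inner_smul_left, inner_smul_left]
  -- (1) `⟪ξ, E η⟫`
  have h1 : ⟪ξ, 𝔇[Real.exp (-τ), (Real.exp_pos _).ne'] η⟫_ℂ =
      (Real.exp (τ / 2) : ℂ) * scalingCoeff ξ η τ := inner_lpDilation_exp ξ η τ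
  -- (2) `⟪ξ, E D η⟫ = ⟪ξ, D_{e^{-(τ+L)}} η⟫`
  have hED : 𝔇[Real.exp (-τ), (Real.exp_pos _).ne'] (𝔇[((p : ℝ)⁻¹), hpinv] η) =
      𝔇[Real.exp (-(τ + L)), (Real.exp_pos _).ne'] η := by
    rw [show 𝔇[Real.exp (-τ), (Real.exp_pos _).ne'] (𝔇[((p : ℝ)⁻¹), hpinv] η) =
      (𝔇[Real.exp (-τ), (Real.exp_pos _).ne'] * 𝔇[((p : ℝ)⁻¹), hpinv]) η from rfl, lpDilation_mul]
    have e : (p : ℝ)⁻¹ * Real.exp (-τ) = Real.exp (-(τ + L)) := by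
      rw [← hpL, ← Real.exp_neg, ← Real.exp_add]
      congr 1
      ring
    rw [lpDilation_congr_scale e]
  have h2 : ⟪ξ, 𝔇[Real.exp (-τ), (Real.exp_pos _).ne'] (𝔇[((p : ℝ)⁻¹), hpinv] η)⟫_ℂ =
      (Real.exp ((τ + L) / 2) : ℂ) * scalingCoeff ξ η (τ + L) := by
    rw [hED, inner_lpDilation_exp]
  -- (3) `⟪D ξ, E η⟫ = p ⟪ξ, D_p E η⟫ = p ⟪ξ, D_{e^{-(τ-L)}} η⟫`
  have hDE : 𝔇[((p : ℝ)⁻¹)⁻¹, inv_ne_zero hpinv] (𝔇[Real.exp (-τ), (Real.exp_pos _).ne'] η) =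
      𝔇[Real.exp (-(τ - L)), (Real.exp_pos _).ne'] η := by
    rw [show 𝔇[((p : ℝ)⁻¹)⁻¹, inv_ne_zero hpinv] (𝔇[Real.exp (-τ), (Real.exp_pos _).ne'] η) =
      (𝔇[((p : ℝ)⁻¹)⁻¹, inv_ne_zero hpinv] * 𝔇[Real.exp (-τ), (Real.exp_pos _).ne']) η from rfl,
      lpDilation_mul]
    have e : Real.exp (-τ) * ((p : ℝ)⁻¹)⁻¹ = Real.exp (-(τ - L)) := by
      rw [inv_inv, ← hpL, ← Real.exp_add]
      congr 1
      ring
    rw [lpDilation_congr_scale e]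
  have habs : ((|((p : ℝ)⁻¹)|⁻¹ : ℝ) : ℂ) = (p : ℂ) := by
    rw [abs_of_pos (inv_pos.2 hp0), inv_inv, Complex.ofReal_natCast]
  have h3 : ⟪𝔇[((p : ℝ)⁻¹), hpinv] ξ, 𝔇[Real.exp (-τ), (Real.exp_pos _).ne'] η⟫_ℂ =
      (p : ℂ) * ((Real.exp ((τ - L) / 2) : ℂ) * scalingCoeff ξ η (τ - L)) := by
    rw [inner_lpDilation_left, habs, hDE, inner_lpDilation_exp]
  -- (4) `⟪D ξ, E D η⟫ = p ⟪ξ, D_p E D η⟫ = p ⟪ξ, E η⟫`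
  have hDED : 𝔇[((p : ℝ)⁻¹)⁻¹, inv_ne_zero hpinv]
      (𝔇[Real.exp (-τ), (Real.exp_pos _).ne'] (𝔇[((p : ℝ)⁻¹), hpinv] η)) =
      𝔇[Real.exp (-τ), (Real.exp_pos _).ne'] η := by
    rw [hED, show 𝔇[((p : ℝ)⁻¹)⁻¹, inv_ne_zero hpinv] (𝔇[Real.exp (-(τ + L)), (Real.exp_pos _).ne'] η) =
      (𝔇[((p : ℝ)⁻¹)⁻¹, inv_ne_zero hpinv] * 𝔇[Real.exp (-(τ + L)), (Real.exp_pos _).ne']) η from rfl,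
      lpDilation_mul]
    have e : Real.exp (-(τ + L)) * ((p : ℝ)⁻¹)⁻¹ = Real.exp (-τ) := by
      rw [inv_inv, ← hpL, ← Real.exp_add]
      congr 1
      ring
    rw [lpDilation_congr_scale e]
  have h4 : ⟪𝔇[((p : ℝ)⁻¹), hpinv] ξ,
      𝔇[Real.exp (-τ), (Real.exp_pos _).ne'] (𝔇[((p : ℝ)⁻¹), hpinv] η)⟫_ℂ =
      (p : ℂ) * ((Real.exp (τ / 2) : ℂ) * scalingCoeff ξ η τ) := by
    rw [inner_lpDilation_left, habs, hDED, inner_lpDilation_exp]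
  rw [h1, h2, h3, h4]
  -- scalar bookkeeping: everything is a real exponential
  have hc : (starRingEnd ℂ) ((p : ℂ)⁻¹) = (p : ℂ)⁻¹ := by
    rw [map_inv₀, Complex.conj_natCast]
  rw [hc]
  have hpC : (p : ℂ) = ((Real.exp L : ℝ) : ℂ) := by rw [hpL, Complex.ofReal_natCast]
  have hpCi : (p : ℂ)⁻¹ = ((Real.exp (-L) : ℝ) : ℂ) := by
    rw [hpC, ← Complex.ofReal_inv, ← Real.exp_neg]
  have e1 : (Real.exp (-τ / 2) : ℂ) * (Real.exp (τ / 2) : ℂ) = 1 := by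
    rw [← Complex.ofReal_mul, ← Real.exp_add, show -τ / 2 + τ / 2 = 0 by ring, Real.exp_zero,
      Complex.ofReal_one]
  have e2 : (Real.exp (-τ / 2) : ℂ) * (p : ℂ)⁻¹ * (Real.exp ((τ + L) / 2) : ℂ) =
      (Real.exp (-(L / 2)) : ℂ) := by
    rw [hpCi, ← Complex.ofReal_mul, ← Complex.ofReal_mul, ← Real.exp_add, ← Real.exp_add]
    congr 2
    ring
  have e3 : (Real.exp (-τ / 2) : ℂ) * (p : ℂ)⁻¹ * (p : ℂ) * (Real.exp ((τ - L) / 2) : ℂ) =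
      (Real.exp (-(L / 2)) : ℂ) := by
    rw [hpCi, hpC, ← Complex.ofReal_mul, ← Complex.ofReal_mul, ← Complex.ofReal_mul,
      ← Real.exp_add, ← Real.exp_add, ← Real.exp_add]
    congr 2
    ring
  have e4 : (Real.exp (-τ / 2) : ℂ) * (p : ℂ)⁻¹ * (p : ℂ)⁻¹ * (p : ℂ) * (Real.exp (τ / 2) : ℂ) =
      (p : ℂ)⁻¹ := by
    rw [hpCi, hpC, ← Complex.ofReal_mul, ← Complex.ofReal_mul, ← Complex.ofReal_mul,
      ← Complex.ofReal_mul, ← Real.exp_add, ← Real.exp_add, ← Real.exp_add, ← Real.exp_add]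
    congr 2
    ring
  have hL2 : -(Real.log (p : ℝ) / 2) = -(L / 2) := by rw [hL]
  rw [hL2]
  linear_combination (scalingCoeff ξ η τ) * e1 + (scalingCoeff ξ η τ) * e4
    - (scalingCoeff ξ η (τ + L)) * e2 - (scalingCoeff ξ η (τ - L)) * e3

/-- **The Gram form of the twist**: `⟪θ_pζ, θ_pζ'⟫ = (1 + p⁻¹)⟪ζ, ζ'⟫ − p^{−1/2}(⟨ζ|ϑ(p)ζ'⟩ + ⟨ζ|ϑ(p⁻¹)ζ'⟩)`,
i.e. `⟪θ_pζ, θ_pζ'⟫ = ⟨ζ | ϑ(m_p) ζ'⟩` with `m_p = (1 + p⁻¹)δ₀ − p^{-1/2}(δ_{log p} + δ_{−log p})` — the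
`S = {∞, p}` inner product on the SAME space (CCM 2024 §4.8: "the choice of the finite set `S` plays a key role in
fixing the inner product").  [cite: ConnesConsaniMoscovici2024, §4.8 p. 15] -/
theorem inner_primeTwist_primeTwist (ζ ζ' : Lp ℂ 2 (volume : Measure ℝ)) :
    ⟪primeTwist p ζ, primeTwist p ζ'⟫_ℂ =
      (1 + (p : ℂ)⁻¹) * ⟪ζ, ζ'⟫_ℂ
        - (Real.exp (-(Real.log p / 2)) : ℂ) *
          (scalingCoeff ζ ζ' (Real.log p) + scalingCoeff ζ ζ' (-Real.log p)) := by
  have h0 : ∀ ξ η : Lp ℂ 2 (volume : Measure ℝ), ⟪ξ, η⟫_ℂ = scalingCoeff ξ η 0 := by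
    intro ξ η
    rw [scalingCoeff_eq_inner, show -(0 : ℝ) / 2 = 0 by ring, Real.exp_zero, Complex.ofReal_one,
      one_mul, lpDilation_congr_scale (show Real.exp (-0) = 1 by rw [neg_zero, Real.exp_zero])
        (Real.exp_pos _).ne' one_ne_zero, lpDilation_one]
    rfl
  rw [h0, h0 ζ ζ', scalingCoeff_primeTwist, zero_add, zero_sub]

/-- **The 3-point twist of a kernel**: `(T_p k)(τ) := (1 + p⁻¹) k(τ) − p^{−1/2}(k(τ − log p) + k(τ + log p))`,
i.e. `T_p k = k ∗ m_p` with `m_p = (1 + p⁻¹)δ₀ − p^{−1/2}(δ_{log p} + δ_{−log p})`, the measure of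
`θ_p* θ_p = (1 + p⁻¹) − p^{−1/2}(ϑ(p) + ϑ(p⁻¹))` on the additive group (`ϑ(e^τ) ↔ δ_τ`); Mellin/Fourier
symbol `k̂(s)·|1 − p^{−1/2−is}|²`.  For `k = g ∗ g*` one has `T_p k = g_p ∗ g_p*` with
`g_p = g − p^{−1/2} g(· − log p)`.  An elementary definition (no source states it; it is the kernel-side
form of CCM 2024 §4.8's twisted inner product). [folklore] -/
def twistKernel (k : ℝ → ℂ) (τ : ℝ) : ℂ :=
  (1 + (p : ℂ)⁻¹) * k τ
    - (Real.exp (-(Real.log p / 2)) : ℂ) * (k (τ - Real.log p) + k (τ + Real.log p))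

omit hp in
/-- Unfolding `twistKernel` (plumbing for `simp`). [folklore] -/
private theorem twistKernel_apply (k : ℝ → ℂ) (τ : ℝ) :
    twistKernel p k τ = (1 + (p : ℂ)⁻¹) * k τ
      - (Real.exp (-(Real.log p / 2)) : ℂ) * (k (τ - Real.log p) + k (τ + Real.log p)) :=
  rfl

/-- **The trace functional under the twist**: `⟨θ_pξ | ϑ(k) θ_pξ⟩ = ⟨ξ | ϑ(T_p k) ξ⟩` for `k ∈ L¹(ℝ)`,
`ξ ∈ L²(ℝ)` — i.e. `soninTraceForm k (θ_p ξ) = soninTraceForm (twistKernel p k) ξ` (from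
`scalingCoeff_primeTwist` and translation invariance of `dτ`).  The diagonal term of the semilocal Sonin
trace `Tr(ϑ(g)𝔖_Sϑ(g)*)` at a vector `θ_pζ` is the archimedean diagonal term for the twisted kernel at `ζ`.
[cite: ConnesConsaniMoscovici2024, §4.8 p. 15] -/
theorem soninTraceForm_primeTwist {k : ℝ → ℂ} (hk : Integrable k) (ξ : Lp ℂ 2 (volume : Measure ℝ)) :
    soninTraceForm k (primeTwist p ξ) = soninTraceForm (twistKernel p k) ξ := by
  set L : ℝ := Real.log p with hL
  set e : ℂ := (Real.exp (-(Real.log p / 2)) : ℂ) with he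
  set c : ℝ → ℂ := fun τ => scalingCoeff ξ ξ τ with hc
  unfold soninTraceForm
  simp only [scalingCoeff_primeTwist, twistKernel_apply]
  -- integrability of the five products
  have i0 : Integrable fun τ => k τ * c τ := integrable_mul_scalingCoeff hk ξ ξ
  have i1 : Integrable fun τ => k τ * c (τ + L) := integrable_mul_scalingCoeff_shift hk ξ ξ L
  have i2 : Integrable fun τ => k τ * c (τ - L) := by
    simpa [sub_eq_add_neg] using integrable_mul_scalingCoeff_shift hk ξ ξ (-L)
  have i3 : Integrable fun τ => k (τ - L) * c τ :=
    integrable_mul_scalingCoeff (hk.comp_sub_right L) ξ ξ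
  have i4 : Integrable fun τ => k (τ + L) * c τ :=
    integrable_mul_scalingCoeff (hk.comp_add_right L) ξ ξ
  -- translation invariance
  have s1 : ∫ τ, k τ * c (τ + L) = ∫ τ, k (τ - L) * c τ := by
    have h := integral_sub_right_eq_self (μ := (volume : Measure ℝ)) (fun τ => k τ * c (τ + L)) L
    simp only [sub_add_cancel] at h
    exact h.symm
  have s2 : ∫ τ, k τ * c (τ - L) = ∫ τ, k (τ + L) * c τ := by
    have h := integral_add_right_eq_self (μ := (volume : Measure ℝ)) (fun τ => k τ * c (τ - L)) L
    simp only [add_sub_cancel_right] at h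
    exact h.symm
  -- left-hand side
  have lhs : ∫ τ, k τ * ((1 + (p : ℂ)⁻¹) * scalingCoeff ξ ξ τ
      - e * (scalingCoeff ξ ξ (τ + Real.log p) + scalingCoeff ξ ξ (τ - Real.log p))) =
      (1 + (p : ℂ)⁻¹) * (∫ τ, k τ * c τ) - e * ((∫ τ, k τ * c (τ + L)) + ∫ τ, k τ * c (τ - L)) := by
    have hf : (fun τ => k τ * ((1 + (p : ℂ)⁻¹) * scalingCoeff ξ ξ τ
        - e * (scalingCoeff ξ ξ (τ + Real.log p) + scalingCoeff ξ ξ (τ - Real.log p)))) =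
        fun τ => (1 + (p : ℂ)⁻¹) * (k τ * c τ) - (e * (k τ * c (τ + L)) + e * (k τ * c (τ - L))) := by
      funext τ
      simp only [hc, hL]
      ring
    have h12 : Integrable fun τ => e * (k τ * c (τ + L)) + e * (k τ * c (τ - L)) :=
      (i1.const_mul e).add (i2.const_mul e)
    have eA : ∫ τ, ((1 + (p : ℂ)⁻¹) * (k τ * c τ) - (e * (k τ * c (τ + L)) + e * (k τ * c (τ - L)))) =
        (∫ τ, (1 + (p : ℂ)⁻¹) * (k τ * c τ)) - ∫ τ, (e * (k τ * c (τ + L)) + e * (k τ * c (τ - L))) :=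
      integral_sub (i0.const_mul _) h12
    have eB : ∫ τ, (e * (k τ * c (τ + L)) + e * (k τ * c (τ - L))) =
        (∫ τ, e * (k τ * c (τ + L))) + ∫ τ, e * (k τ * c (τ - L)) :=
      integral_add (i1.const_mul e) (i2.const_mul e)
    rw [hf, eA, eB, integral_const_mul, integral_const_mul, integral_const_mul, mul_add]
  -- right-hand side
  have rhs : ∫ τ, ((1 + (p : ℂ)⁻¹) * k τ - e * (k (τ - Real.log p) + k (τ + Real.log p))) *
      scalingCoeff ξ ξ τ =
      (1 + (p : ℂ)⁻¹) * (∫ τ, k τ * c τ) - e * ((∫ τ, k (τ - L) * c τ) + ∫ τ, k (τ + L) * c τ) := by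
    have hf : (fun τ => ((1 + (p : ℂ)⁻¹) * k τ - e * (k (τ - Real.log p) + k (τ + Real.log p))) *
        scalingCoeff ξ ξ τ) =
        fun τ => (1 + (p : ℂ)⁻¹) * (k τ * c τ) - (e * (k (τ - L) * c τ) + e * (k (τ + L) * c τ)) := by
      funext τ
      simp only [hc, hL]
      ring
    have h34 : Integrable fun τ => e * (k (τ - L) * c τ) + e * (k (τ + L) * c τ) :=
      (i3.const_mul e).add (i4.const_mul e)
    have eA : ∫ τ, ((1 + (p : ℂ)⁻¹) * (k τ * c τ) - (e * (k (τ - L) * c τ) + e * (k (τ + L) * c τ))) =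
        (∫ τ, (1 + (p : ℂ)⁻¹) * (k τ * c τ)) - ∫ τ, (e * (k (τ - L) * c τ) + e * (k (τ + L) * c τ)) :=
      integral_sub (i0.const_mul _) h34
    have eB : ∫ τ, (e * (k (τ - L) * c τ) + e * (k (τ + L) * c τ)) =
        (∫ τ, e * (k (τ - L) * c τ)) + ∫ τ, e * (k (τ + L) * c τ) :=
      integral_add (i3.const_mul e) (i4.const_mul e)
    rw [hf, eA, eB, integral_const_mul, integral_const_mul, integral_const_mul, mul_add]
  rw [lhs, rhs, s1, s2]

end Twist

/-! ## The weak-trace inequalities over `𝔖_S(α, β)` are twisted archimedean inequalities over `S(α, β)` -/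

section WeakTrace

variable (p : ℕ) [hp : Fact p.Prime]

/-- **Reformulation of every semilocal weak-trace bound in archimedean terms.**  For `k ∈ L¹(ℝ)`, radii
`α, β` and a constant `C`, the following are equivalent:
(i) for every finite orthonormal family `ξ₁, …, ξₙ` of the semilocal Sonin space `𝔖_S(α, β) = θ_p(S(α,β))`,
`Σ_i Re⟨ξ_i | ϑ(k) ξ_i⟩ ≤ C`;
(ii) for every finite family `ζ₁, …, ζₙ` of CC's archimedean Sonin space `S(α, β)` whose twists `θ_pζ_i` are
orthonormal (equivalently, by `inner_primeTwist_primeTwist`, `⟨ζ_i | ϑ(m_p) ζ_j⟩ = δ_ij`),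
`Σ_i Re⟨ζ_i | ϑ(T_p k) ζ_i⟩ ≤ C` with the twisted kernel `T_p k = twistKernel p k`.
With `k = g ⋆ g̃`, `α = β = 1` and `C = Re(W_∞(k) − W_p(k))`, (i) is the cell `rh-explicit`'s summit-side
"Connes–Consani-shaped inequality with a prime" and (ii) says the prime enters only through the 3-point
twists of the kernel and of the Gram form (CCM 2024 §4.8's remark, quantified).  Elementary: combine
`mem_semilocalSoninSpace_iff` (Thm. 4.6 as the definition) with `soninTraceForm_primeTwist`.
[cite: ConnesConsaniMoscovici2024, Thm. 4.6 §4.7 p. 15; §4.8 p. 15] -/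
theorem semilocal_weakTrace_iff {k : ℝ → ℂ} (hk : Integrable k) (α β C : ℝ) :
    (∀ (n : ℕ) (ξ : Fin n → Lp ℂ 2 (volume : Measure ℝ)),
        Orthonormal ℂ ξ → (∀ i, ξ i ∈ semilocalSoninSpace p α β) →
          ∑ i, (soninTraceForm k (ξ i : ℝ → ℂ)).re ≤ C) ↔
    (∀ (n : ℕ) (ζ : Fin n → Lp ℂ 2 (volume : Measure ℝ)),
        Orthonormal ℂ (fun i => primeTwist p (ζ i)) → (∀ i, ζ i ∈ soninSpace α β) →
          ∑ i, (soninTraceForm (twistKernel p k) (ζ i : ℝ → ℂ)).re ≤ C) := by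
  constructor
  · intro h n ζ hON hmem
    have h' := h n (fun i => primeTwist p (ζ i)) hON
      (fun i => primeTwist_mem_semilocalSoninSpace p (hmem i))
    simpa only [soninTraceForm_primeTwist p hk] using h'
  · intro h n ξ hON hmem
    choose ζ hζ hξ using fun i => (mem_semilocalSoninSpace_iff p).1 (hmem i)
    have hξ' : (fun i => primeTwist p (ζ i)) = ξ := funext hξ
    have h' := h n ζ (hξ' ▸ hON) hζ
    have hsum : ∀ i, (soninTraceForm (twistKernel p k) (ζ i : ℝ → ℂ)).re =
        (soninTraceForm k (ξ i : ℝ → ℂ)).re := fun i => by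
      rw [← soninTraceForm_primeTwist p hk, hξ i]
    simpa only [hsum] using h'

end WeakTrace

/-! ## Appended (same seat): homogeneity of the trace functional and the one-vector refutation criterion

A weak-trace bound "`Σ_i Re⟨ξ_i|ϑ(k)ξ_i⟩ ≤ C` over all finite orthonormal families of `𝔖_S(α,β)`" is
refuted by ONE vector: any `η ∈ 𝔖_S(α,β)`, `η ≠ 0`, with `Re⟨η|ϑ(k)η⟩ > C‖η‖²` (normalise `η`).  In the
twisted (archimedean) form of `semilocal_weakTrace_iff`: any `ζ ∈ S(α,β)`, `ζ ≠ 0`, with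
`Re⟨ζ|ϑ(T_p k)ζ⟩ > C‖θ_pζ‖²`.  This is the Lean landing point of a finite certificate against the cell
`rh-explicit`'s summit-side obligation (HOME/cc-s2-1/S2-CERT-SPEC.md, certificate C1); nothing here
asserts that such a vector exists. -/

section Homogeneity

/-- Sesquilinearity of the scaling coefficient in a common scalar: `⟨cξ | ϑ(e^τ)(cη)⟩ = c̄c ⟨ξ | ϑ(e^τ) η⟩`
(CC 2021 eq. (40): `ϑ` is linear; elementary). [cite: ConnesConsani2021, §4 eq. (40) p. 15] -/
theorem scalingCoeff_smul (c : ℂ) (ξ η : Lp ℂ 2 (volume : Measure ℝ)) (τ : ℝ) :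
    scalingCoeff ((c • ξ : Lp ℂ 2 (volume : Measure ℝ)) : ℝ → ℂ)
        ((c • η : Lp ℂ 2 (volume : Measure ℝ)) : ℝ → ℂ) τ =
      (starRingEnd ℂ) c * c * scalingCoeff ξ η τ := by
  rw [scalingCoeff_eq_inner, scalingCoeff_eq_inner, map_smul, inner_smul_left, inner_smul_right]
  ring

/-- Homogeneity of the diagonal coefficient of `ϑ(k)`: `⟨cξ | ϑ(k)(cξ)⟩ = c̄c ⟨ξ | ϑ(k) ξ⟩` (the printed
`⟨ξ|ϑ(f)ξ⟩ = ∫ f(λ)⟨ξ|ϑ(λ)ξ⟩d*λ`, Prop. 2.2 (iii), is quadratic in `ξ`). [cite: ConnesConsani2021, Prop. 2.2 (iii) p. 10] -/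
theorem soninTraceForm_smul (k : ℝ → ℂ) (c : ℂ) (ξ : Lp ℂ 2 (volume : Measure ℝ)) :
    soninTraceForm k ((c • ξ : Lp ℂ 2 (volume : Measure ℝ)) : ℝ → ℂ) =
      (starRingEnd ℂ) c * c * soninTraceForm k ξ := by
  unfold soninTraceForm
  rw [← integral_const_mul]
  refine integral_congr_ae (Eventually.of_forall fun τ => ?_)
  simp only [scalingCoeff_smul]
  ring

end Homogeneity

section OneVector

variable (p : ℕ) [hp : Fact p.Prime]

/-- **One-vector refutation criterion** for weak-trace bounds over the semilocal Sonin space: if some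
`η ∈ 𝔖_S(α,β)`, `η ≠ 0`, has `Re⟨η | ϑ(k) η⟩ > C‖η‖²`, then the bound "`Σ_i Re⟨ξ_i|ϑ(k)ξ_i⟩ ≤ C` for
every finite orthonormal family `ξ_i ∈ 𝔖_S(α,β)`" fails (at the one-element family `η/‖η‖`).  Pure
normalisation; the semilocal Sonin space is the printed object of CCM 2024 Def. 4.5 / Thm. 4.6.
[cite: ConnesConsaniMoscovici2024, Thm. 4.6 §4.7 p. 15] -/
theorem not_semilocal_weakTrace_of_vector {k : ℝ → ℂ} {α β C : ℝ}
    {η : Lp ℂ 2 (volume : Measure ℝ)} (hη : η ∈ semilocalSoninSpace p α β) (hη0 : η ≠ 0)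
    (hgt : C * ‖η‖ ^ 2 < (soninTraceForm k η).re) :
    ¬ (∀ (n : ℕ) (ξ : Fin n → Lp ℂ 2 (volume : Measure ℝ)),
        Orthonormal ℂ ξ → (∀ i, ξ i ∈ semilocalSoninSpace p α β) →
          ∑ i, (soninTraceForm k (ξ i : ℝ → ℂ)).re ≤ C) := by
  intro h
  have hpos : 0 < ‖η‖ := norm_pos_iff.mpr hη0
  have hnorm : ‖η‖ ≠ 0 := hpos.ne'
  set r : ℝ := ‖η‖⁻¹ with hr
  set ξ : Fin 1 → Lp ℂ 2 (volume : Measure ℝ) := fun _ => ((r : ℂ) • η) with hξ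
  have hON : Orthonormal ℂ ξ := by
    refine ⟨fun i => ?_, Subsingleton.pairwise⟩
    rw [hξ, norm_smul, Complex.norm_real, Real.norm_eq_abs, hr, abs_of_pos (inv_pos.mpr hpos),
      inv_mul_cancel₀ hnorm]
  have hmem : ∀ i, ξ i ∈ semilocalSoninSpace p α β := fun _ => Submodule.smul_mem _ _ hη
  have hle := h 1 ξ hON hmem
  rw [Fin.sum_univ_one, hξ, soninTraceForm_smul, Complex.conj_ofReal, ← Complex.ofReal_mul,
    Complex.re_ofReal_mul] at hle
  -- `hle : r * r * Re⟨η|ϑ(k)η⟩ ≤ C`; multiply by `‖η‖²`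
  have hkey : (soninTraceForm k η).re ≤ C * ‖η‖ ^ 2 := by
    have h2 : (soninTraceForm k (η : ℝ → ℂ)).re =
        ‖η‖ ^ 2 * (r * r * (soninTraceForm k (η : ℝ → ℂ)).re) := by
      rw [hr]
      field_simp
    rw [h2]
    calc ‖η‖ ^ 2 * (r * r * (soninTraceForm k (η : ℝ → ℂ)).re) ≤ ‖η‖ ^ 2 * C := by gcongr
      _ = C * ‖η‖ ^ 2 := by ring
  linarith

/-- **One-vector refutation criterion, twisted (archimedean) form**: if some `ζ` in CC's archimedean
Sonin space `S(α,β)`, `ζ ≠ 0`, satisfies `Re⟨ζ | ϑ(T_p k) ζ⟩ > C‖θ_pζ‖²` (`T_p k = twistKernel p k`,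
`k ∈ L¹`), then the weak-trace bound with constant `C` over `𝔖_S(α,β) = θ_p S(α,β)` fails — by
`soninTraceForm_primeTwist` this is the previous criterion at `η = θ_pζ`.  The data `(ζ, k, C)` are
archimedean: no semilocal object needs to be evaluated.
[cite: ConnesConsaniMoscovici2024, Thm. 4.6 §4.7 p. 15; §4.8 p. 15] -/
theorem not_semilocal_weakTrace_of_twisted_vector {k : ℝ → ℂ} (hk : Integrable k) {α β C : ℝ}
    {ζ : Lp ℂ 2 (volume : Measure ℝ)} (hζ : ζ ∈ soninSpace α β) (hζ0 : ζ ≠ 0)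
    (hgt : C * ‖primeTwist p ζ‖ ^ 2 < (soninTraceForm (twistKernel p k) ζ).re) :
    ¬ (∀ (n : ℕ) (ξ : Fin n → Lp ℂ 2 (volume : Measure ℝ)),
        Orthonormal ℂ ξ → (∀ i, ξ i ∈ semilocalSoninSpace p α β) →
          ∑ i, (soninTraceForm k (ξ i : ℝ → ℂ)).re ≤ C) := by
  have hη0 : primeTwist p ζ ≠ 0 := by
    intro h0
    apply hζ0
    have h1 : primeTwistEquiv p ζ = 0 := by rw [primeTwistEquiv_apply]; exact h0
    exact (primeTwistEquiv p).map_eq_zero_iff.mp h1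
  refine not_semilocal_weakTrace_of_vector p (primeTwist_mem_semilocalSoninSpace p hζ) hη0 ?_
  rwa [soninTraceForm_primeTwist p hk]

end OneVector

/-! ## Appended (same seat, 3): the twisted norm in archimedean terms

For the one-vector criterion the quantity `‖θ_pζ‖²` must itself be computed from archimedean data:
`‖θ_pζ‖² = (1 + p⁻¹)‖ζ‖² − 2p^{−1/2} Re⟨ζ | ϑ(p) ζ⟩`, using the conjugate symmetry
`⟨ξ | ϑ(e^{−τ}) η⟩ = conj ⟨η | ϑ(e^{τ}) ξ⟩` of the matrix coefficients of the unitary `ϑ`. -/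

section TwistedNorm

/-- **Conjugate symmetry of the scaling coefficients**: `⟨ξ | ϑ(e^{−τ}) η⟩ = conj ⟨η | ϑ(e^τ) ξ⟩`
(`ϑ(e^{−τ}) = ϑ(e^τ)*`, unitarity of CC's scaling representation, eq. (40)).
[cite: ConnesConsani2021, §4 eq. (40) p. 15] -/
theorem scalingCoeff_neg (ξ η : Lp ℂ 2 (volume : Measure ℝ)) (τ : ℝ) :
    scalingCoeff ξ η (-τ) = (starRingEnd ℂ) (scalingCoeff η ξ τ) := by
  rw [scalingCoeff_eq_inner, scalingCoeff_eq_inner, map_mul, Complex.conj_ofReal, inner_conj_symm,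
    inner_lpDilation_left, ← mul_assoc]
  have hscale : 𝔇[(Real.exp (-τ))⁻¹, inv_ne_zero (Real.exp_pos (-τ)).ne'] =
      (𝔇[Real.exp (-(-τ)), (Real.exp_pos _).ne'] :
        Lp ℂ 2 (volume : Measure ℝ) →L[ℂ] Lp ℂ 2 (volume : Measure ℝ)) :=
    lpDilation_congr_scale (by rw [← Real.exp_neg]) _ _
  rw [hscale]
  congr 1
  rw [abs_of_pos (Real.exp_pos _), ← Real.exp_neg, neg_neg, ← Complex.ofReal_mul, ← Real.exp_add]
  congr 2
  ring

variable (p : ℕ) [hp : Fact p.Prime]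

/-- **The twisted norm from archimedean data**:
`‖θ_pζ‖² = (1 + p⁻¹)‖ζ‖² − 2e^{−(log p)/2} Re⟨ζ | ϑ(p) ζ⟩` (= `⟨ζ | ϑ(m_p) ζ⟩`; real part of
`inner_primeTwist_primeTwist` with `⟨ζ|ϑ(p⁻¹)ζ⟩ = conj⟨ζ|ϑ(p)ζ⟩`).  This is the normalising quantity of the
one-vector criterion `not_semilocal_weakTrace_of_twisted_vector`. [cite: ConnesConsaniMoscovici2024, §4.8 p. 15] -/
theorem norm_sq_primeTwist (ζ : Lp ℂ 2 (volume : Measure ℝ)) :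
    ‖primeTwist p ζ‖ ^ 2 =
      (1 + (p : ℝ)⁻¹) * ‖ζ‖ ^ 2
        - 2 * Real.exp (-(Real.log p / 2)) * (scalingCoeff ζ ζ (Real.log p)).re := by
  have h := inner_primeTwist_primeTwist p ζ ζ
  rw [scalingCoeff_neg] at h
  have hc : scalingCoeff ζ ζ (Real.log p) + (starRingEnd ℂ) (scalingCoeff ζ ζ (Real.log p)) =
      ((2 * (scalingCoeff ζ ζ (Real.log p)).re : ℝ) : ℂ) := by
    rw [Complex.add_conj]
  have hp' : (1 + (p : ℂ)⁻¹) = ((1 + (p : ℝ)⁻¹ : ℝ) : ℂ) := by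
    rw [Complex.ofReal_add, Complex.ofReal_one, Complex.ofReal_inv, Complex.ofReal_natCast]
  have hzz : ⟪ζ, ζ⟫_ℂ = ((‖ζ‖ ^ 2 : ℝ) : ℂ) := by
    rw [inner_self_eq_norm_sq_to_K]
    norm_cast
  have key : ⟪primeTwist p ζ, primeTwist p ζ⟫_ℂ =
      (((1 + (p : ℝ)⁻¹) * ‖ζ‖ ^ 2
        - Real.exp (-(Real.log p / 2)) * (2 * (scalingCoeff ζ ζ (Real.log p)).re) : ℝ) : ℂ) := by
    rw [h, hc, hp', hzz, ← Complex.ofReal_mul, ← Complex.ofReal_mul, ← Complex.ofReal_sub]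
  have hre := congrArg Complex.re key
  rw [Complex.ofReal_re] at hre
  have hn : ‖primeTwist p ζ‖ ^ 2 = (⟪primeTwist p ζ, primeTwist p ζ⟫_ℂ).re := by
    rw [← inner_self_eq_norm_sq (𝕜 := ℂ) (primeTwist p ζ)]
    rfl
  rw [hn, hre]
  ring

end TwistedNorm

end Literature.NumberTheory.ConnesConsani2021
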